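import Summits.QuantumFields.YangMills.Theorems.SmallCircleAnchorAnchorGapCovLineDerivative
import Summits.QuantumFields.YangMills.Theorems.SmallCircleAnchorAnchorGapCovLineDop

/-!
# Crux `AnchorGap` (stmt-QuantumFields-11141), line `registered` — ITERATED line derivatives of GREP's
# peeled expectation (step (G2) of the assembly of GREP, part 4: the `foldl` along a script's lines)

Putting ✓`LineDeriv.fderiv_gaussExpect_cov_single` (HEAT along one pair coordinate) and
✓`LineDop.heatSum_eq_gaussExpect_dop` / `LineDop.dop_mem_class` (the heat sum is GREP's `Dop`, the class
is stable) together and iterating along a list of lines `ℓ₁, …, ℓ_k` between atoms of `X` — exactly the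
`s.lines.foldl` of ✓PEEL and of GREP's activity `K X` —: on the open positive definite locus,
`(L.foldl (g ℓ ↦ (x ↦ fderiv g x e_ℓ)) (σ ↦ E(cov X σ)(H))) σ = E(cov X σ)(L.foldl (H ℓ ↦ Dop ℓ H) H)`
(`foldl_fderiv_eq_gaussExpect_foldl_dop`).  The iterated `fderiv` only sees the values on the open locus
(`foldl_fderiv_congr_of_isOpen`, `Filter.EventuallyEq.fderiv_eq`).  [folklore]; no definition.
-/

set_option autoImplicit false

namespace Summit.QuantumFields.YangMills.Theorems.AnchorGap.LineIterate

open Finset MeasureTheory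
open scoped Matrix Topology

variable {ι β : Type} [Fintype ι] [DecidableEq ι] [Fintype β] [DecidableEq β]

omit [Fintype ι] [DecidableEq ι] [Fintype β] in
/-- Iterated coordinate `fderiv`s along a list only see the values on an open set. [folklore] -/
theorem foldl_fderiv_congr_of_isOpen {U : Set (Sym2 β → ℝ)} (hU : IsOpen U) :
    ∀ (L : List (Sym2 β)) (g₁ g₂ : (Sym2 β → ℝ) → ℝ), (∀ x ∈ U, g₁ x = g₂ x) → ∀ x ∈ U,
      (L.foldl (fun (g : (Sym2 β → ℝ) → ℝ) (ℓ : Sym2 β) => fun x : Sym2 β → ℝ =>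
          fderiv ℝ g x (Pi.single ℓ 1)) g₁) x
        = (L.foldl (fun (g : (Sym2 β → ℝ) → ℝ) (ℓ : Sym2 β) => fun x : Sym2 β → ℝ =>
          fderiv ℝ g x (Pi.single ℓ 1)) g₂) x := by
  intro L
  induction L with
  | nil => intro g₁ g₂ h x hx; exact h x hx
  | cons ℓ L ih =>
    intro g₁ g₂ h x hx
    simp only [List.foldl_cons]
    refine ih _ _ (fun y hy => ?_) x hx
    have heq : g₁ =ᶠ[𝓝 y] g₂ :=
      Filter.eventually_of_mem (hU.mem_nhds hy) fun z hz => h z hz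
    simp only [heq.fderiv_eq]

/-- **Iterated line derivatives of the peeled expectation.** For `C` positive definite, atoms `blk`,
an atom set `X`, a list `L` of lines between atoms of `X`, `H` of the smooth polynomial-growth class
and `σ` with `cov X σ` positive definite:
`(L.foldl (g ℓ ↦ x ↦ fderiv g x e_ℓ) (σ ↦ E(cov X σ)(H))) σ = E(cov X σ)(L.foldl (H ℓ ↦ Dop ℓ H) H)`.
[folklore] -/
theorem foldl_fderiv_eq_gaussExpect_foldl_dop (blk : ι → β) (C : Matrix ι ι ℝ) (hC : C.PosDef)
    (X : Finset β) :
    ∀ (L : List (Sym2 β)), (∀ ℓ ∈ L, ∃ p q : β, p ∈ X ∧ q ∈ X ∧ ℓ = s(p, q)) →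
      ∀ (H : (ι → ℝ) → ℝ), ContDiff ℝ (⊤ : ℕ∞) H →
        (∀ n : ℕ, ∃ (K : ℝ) (m : ℕ), ∀ φ : ι → ℝ, ‖iteratedFDeriv ℝ n H φ‖ ≤ K * (1 + ∑ i, φ i ^ 2) ^ m) →
        ∀ σ : Sym2 β → ℝ, (Matrix.of fun i j : ι => (if blk i = blk j then 1 else if blk i ∈ X ∧ blk j ∈ X
          then σ s(blk i, blk j) else 0) * C i j).PosDef →
        (L.foldl (fun (g : (Sym2 β → ℝ) → ℝ) (ℓ : Sym2 β) => fun x : Sym2 β → ℝ =>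
            fderiv ℝ g x (Pi.single ℓ 1))
          (fun σ : Sym2 β → ℝ =>
            (∫ φ : ι → ℝ, H φ * Real.exp (-(φ ⬝ᵥ ((Matrix.of fun i j : ι =>
                (if blk i = blk j then 1 else if blk i ∈ X ∧ blk j ∈ X then σ s(blk i, blk j) else 0)
                  * C i j)⁻¹ *ᵥ φ)) / 2))
            / ∫ φ : ι → ℝ, Real.exp (-(φ ⬝ᵥ ((Matrix.of fun i j : ι =>
                (if blk i = blk j then 1 else if blk i ∈ X ∧ blk j ∈ X then σ s(blk i, blk j) else 0)
                  * C i j)⁻¹ *ᵥ φ)) / 2))) σ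
        = (∫ φ : ι → ℝ, (L.foldl (fun (K : (ι → ℝ) → ℝ) (ℓ : Sym2 β) => fun φ : ι → ℝ =>
              (1 / 2 : ℝ) * ∑ x : ι, ∑ y : ι,
                if s(blk x, blk y) = ℓ ∧ blk x ≠ blk y
                  then C x y * iteratedFDeriv ℝ 2 K φ ![Pi.single x 1, Pi.single y 1] else 0) H) φ
            * Real.exp (-(φ ⬝ᵥ ((Matrix.of fun i j : ι =>
                (if blk i = blk j then 1 else if blk i ∈ X ∧ blk j ∈ X then σ s(blk i, blk j) else 0)
                  * C i j)⁻¹ *ᵥ φ)) / 2))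
          / ∫ φ : ι → ℝ, Real.exp (-(φ ⬝ᵥ ((Matrix.of fun i j : ι =>
                (if blk i = blk j then 1 else if blk i ∈ X ∧ blk j ∈ X then σ s(blk i, blk j) else 0)
                  * C i j)⁻¹ *ᵥ φ)) / 2) := by
  -- notation
  set cv : (Sym2 β → ℝ) → Matrix ι ι ℝ := fun σ => Matrix.of fun i j : ι =>
    (if blk i = blk j then 1 else if blk i ∈ X ∧ blk j ∈ X then σ s(blk i, blk j) else 0) * C i j
    with hcv
  set Ef : Matrix ι ι ℝ → ((ι → ℝ) → ℝ) → ℝ := fun M F =>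
    (∫ φ : ι → ℝ, F φ * Real.exp (-(φ ⬝ᵥ (M⁻¹ *ᵥ φ)) / 2))
      / ∫ φ : ι → ℝ, Real.exp (-(φ ⬝ᵥ (M⁻¹ *ᵥ φ)) / 2) with hEf
  set Dop : Sym2 β → ((ι → ℝ) → ℝ) → ((ι → ℝ) → ℝ) := fun ℓ K φ => (1 / 2 : ℝ) * ∑ x : ι, ∑ y : ι,
    if s(blk x, blk y) = ℓ ∧ blk x ≠ blk y
      then C x y * iteratedFDeriv ℝ 2 K φ ![Pi.single x 1, Pi.single y 1] else 0 with hDop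
  set step : ((Sym2 β → ℝ) → ℝ) → Sym2 β → ((Sym2 β → ℝ) → ℝ) :=
    fun g ℓ x => fderiv ℝ g x (Pi.single ℓ 1) with hstep
  -- the open PD locus
  have hcd : Continuous (fun σ : Sym2 β → ℝ => fun i j : ι => cv σ i j) := by
    refine continuous_pi fun i => continuous_pi fun j => ?_
    by_cases h1 : blk i = blk j
    · simp only [hcv, Matrix.of_apply, if_pos h1]; exact continuous_const
    · by_cases h2 : blk i ∈ X ∧ blk j ∈ X
      · simp only [hcv, Matrix.of_apply, if_neg h1, if_pos h2]
        exact (continuous_apply (s(blk i, blk j))).mul continuous_const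
      · simp only [hcv, Matrix.of_apply, if_neg h1, if_neg h2]; exact continuous_const
  have hsy : ∀ σ' : Sym2 β → ℝ, (Matrix.of (fun i j : ι => cv σ' i j)).IsSymm := by
    intro σ'
    have hCs : ∀ i j, C j i = C i j := fun i j => by simpa using (hC.isHermitian.apply j i).symm
    ext i j
    simp only [Matrix.transpose_apply, Matrix.of_apply, hcv]
    rw [hCs i j, Sym2.eq_swap]
    by_cases h1 : blk i = blk j
    · rw [if_pos h1, if_pos h1.symm]
    · rw [if_neg h1, if_neg (Ne.symm h1)]
      simp only [and_comm]
  have hUo : IsOpen {σ' : Sym2 β → ℝ | (Matrix.of (fun i j : ι => cv σ' i j)).PosDef} :=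
    GaussSmooth.isOpen_posDef_preimage hcd hsy
  -- induction on the list, for every observable of the class at once
  intro L
  induction L with
  | nil => intro _ H _ _ σ _; rfl
  | cons ℓ L ih =>
    intro hL H hH hb σ hσ
    obtain ⟨p, q, hp, hq, rfl⟩ := hL _ (List.mem_cons_self)
    have hL' : ∀ ℓ' ∈ L, ∃ p q : β, p ∈ X ∧ q ∈ X ∧ ℓ' = s(p, q) := fun ℓ' h => hL ℓ' (List.mem_cons_of_mem _ h)
    show (L.foldl step (step (fun σ => Ef (cv σ) H) s(p, q))) σ
      = Ef (cv σ) (L.foldl (fun K ℓ => Dop ℓ K) (Dop s(p, q) H))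
    -- one step, valid on the whole open locus
    have hone : ∀ x ∈ {σ' : Sym2 β → ℝ | (Matrix.of (fun i j : ι => cv σ' i j)).PosDef},
        step (fun σ => Ef (cv σ) H) s(p, q) x = Ef (cv x) (Dop s(p, q) H) := by
      intro x hx
      have h1 := LineDeriv.fderiv_gaussExpect_cov_single blk C hC X hH hb hx s(p, q)
      have h2 := LineDop.heatSum_eq_gaussExpect_dop blk C hC.isHermitian X hp hq (cv x) hx hH hb
      simp only [hstep, hEf, hDop]
      rw [h1]
      exact h2
    rw [foldl_fderiv_congr_of_isOpen hUo L _ _ hone σ hσ]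
    exact ih hL' (Dop s(p, q) H) (LineDop.dop_contDiff blk C _ hH) (LineDop.dop_mem_class blk C _ hH hb) σ hσ

end Summit.QuantumFields.YangMills.Theorems.AnchorGap.LineIterate
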